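import Mathlib
import Summits.Ventures.DiscreteObjects.Mahler.TraceDiscRoot
import Summits.Ventures.DiscreteObjects.Mahler.Height1CensusData46

/-!
# Disc root certificate, coefficient-list form (venture `DiscreteObjects`, target L)

Cell `pub-namedobj`, seat `pub-namedobj-mahler` (gen 11). Framing: lottery ticket; floor = certified
bounds/negative ranges.

`exists_root_near` (file `TraceDiscRoot`) takes the second-derivative majorant as a sum over the coefficients of
`Q''`; for trace polynomials of degree `≥ 24` extracting those coefficients from a polynomial literal by `simp` exceeds
the default heartbeat budget.  This variant states the same certificate for `Q = ofCoeffs l` with the majorant written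
directly in the list entries, `Σ_{k < |l|} (k + 1)(k + 2) |l_{k+2}| R^k ≤ L̄` (`coeff_ofCoeffs`, `coeff_derivative`), which
`simp`/`norm_num` evaluate in linear time.

* `exists_root_near_ofCoeffs` — the certificate for `ofCoeffs l`.
-/

namespace Summit.Ventures.DiscreteObjects.Mahler

open Polynomial

/-- **Root certificate, list form.**  As `exists_root_near`, for `Q = ofCoeffs l` (`l ≠ []`), with the majorant
hypothesis `Σ_{k < |l|} (k + 1)(k + 2)·|l.getD (k + 2) 0|·R^k ≤ L̄`. -/
theorem exists_root_near_ofCoeffs (l : List ℤ) (hl : l ≠ []) (c : ℂ) {ρ R η μ Lbar κ : ℝ} (hρ : 0 < ρ)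
    (hR : Complex.normSq c ≤ (R - ρ) ^ 2) (hRρ : ρ ≤ R)
    (hη : Complex.normSq (aeval c (ofCoeffs l)) ≤ η ^ 2) (hη0 : 0 ≤ η)
    (hμ : μ ^ 2 ≤ Complex.normSq (aeval c (derivative (ofCoeffs l)))) (hμ0 : 0 < μ)
    (hL : ∑ k ∈ Finset.range l.length,
        ((k : ℝ) + 1) * ((k : ℝ) + 2) * |((l.getD (k + 2) 0 : ℤ) : ℝ)| * R ^ k ≤ Lbar)
    (hκ : Lbar * ρ ≤ κ * μ) (hκ0 : 0 ≤ κ) (hκ1 : κ < 1) (hclose : η ≤ (1 - κ) * ρ * μ) :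
    ∃ z : ℂ, ‖z - c‖ ≤ ρ ∧ aeval z (ofCoeffs l) = 0 := by
  have hR0 : 0 ≤ R := le_trans hρ.le hRρ
  refine exists_root_near (ofCoeffs l) c hρ hR hRρ hη hη0 hμ hμ0 (le_trans ?_ hL) hκ hκ0 hκ1 hclose
  -- coefficients of `Q''` from the list
  have hcoef : ∀ k : ℕ, |((derivative (derivative (ofCoeffs l))).coeff k : ℝ)| * R ^ k =
      ((k : ℝ) + 1) * ((k : ℝ) + 2) * |((l.getD (k + 2) 0 : ℤ) : ℝ)| * R ^ k := by
    intro k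
    rw [coeff_derivative, coeff_derivative, coeff_ofCoeffs]
    push_cast
    rw [show k + 1 + 1 = k + 2 by ring, abs_mul, abs_mul,
      abs_of_nonneg (by positivity : (0 : ℝ) ≤ (k : ℝ) + 1 + 1), abs_of_nonneg (by positivity : (0 : ℝ) ≤ (k : ℝ) + 1)]
    ring
  simp_rw [hcoef]
  -- the degree of `ofCoeffs l` is `< |l|`
  have hdeg : (ofCoeffs l).natDegree + 1 ≤ l.length := by
    have hlen : 0 < l.length := List.length_pos_of_ne_nil hl
    have : (ofCoeffs l).natDegree ≤ l.length - 1 := by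
      rw [natDegree_le_iff_coeff_eq_zero]
      intro N hN
      rw [coeff_ofCoeffs, List.getD_eq_default _ _ (by omega)]
    omega
  exact Finset.sum_le_sum_of_subset_of_nonneg (Finset.range_subset_range.mpr hdeg)
    (fun k _ _ => by positivity)

end Summit.Ventures.DiscreteObjects.Mahler
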